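import Literature.AlgebraicGeometry.Milne1999.SpecialLefschetzGroupInvariantsSp2Multiplicity
import Literature.AlgebraicGeometry.Milne1999.SpecialLefschetzGroupInvariantsFiniteProducts
import Literature.AlgebraicGeometry.Milne1999.SpecialLefschetzGroupInvariantsRealMultiplication
import Literature.AlgebraicGeometry.Milne1999.SpecialLefschetzGroupInvariantsHodgeClasses
import HarnessLib

/-!
# Milne 1999, Cor. 4.5 / Thm. 3.2 / Prop. 3.6 (a) with multiplicity: the `S`-invariants of ALL POWERS of a
# complex abelian variety with real multiplication of `GL₂`-type are Lefschetz classes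

Family `hodge`, layer `Literature/AlgebraicGeometry/Milne1999`, namespace
`Literature.AlgebraicGeometry.Milne1999` (D-0022). THEOREMS ONLY (no definition, no named fact, no `sorry`;
D-0026, net debt 0). Written for the cell `pub-hodgecm2` (COR-CM), seat `lit-milne`, binder table
`HOME/lit/milne.md` rows M2/M4 (the record `Milne1999_specialLefschetzGroup_invariants_le` of
`Milne1999/LefschetzGroup`: Cor. 4.5 with Thm. 4.4 and Thm. 3.2, whose CONCLUSION is proved here on a new
locus). Sequel of `Milne1999/SpecialLefschetzGroupInvariantsRealMultiplication` (one copy: the `S(A)`-invariants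
of `A` itself, `S(A)(ℂ) = ∏ₖ Sp(V_k)`) and of `Milne1999/SpecialLefschetzGroupInvariantsSp2Multiplicity` (the
abstract `Sp₂`-blocks-with-multiplicity criterion, through the tree's first fundamental theorem for `SL₂` in
the word model). The FIRST locus of the record with a NON-CM isotypic component of multiplicity `≥ 2`
(`SpecialLefschetzGroupInvariantsFiniteProducts`, "What is NOT here").

## Source, verbatim

J. S. Milne, *Lefschetz classes on abelian varieties*, Duke Math. J. 96 (1999) 639–675
[`paper:doi-10-1215-s0012-7094-99-09620-5`, held; PDF page = printed page − 638; re-read 2026-08-21]: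

* §1 p. 643 (p0005 L12–L13): "For any positive integer `r`, `V(A^r) = rV(A)`, and the diagonal action of
  `C(A)` on `rV(A)` identifies `C(A)` with `C(A^r)` (as `k`-algebras with involution)."  p. 644 (p0006
  L20–L28): "Clearly `S(A)` depends only on the isogeny class of `A` […] Proposition 1.5. Let `A₁, …, A_s`
  be a set of representatives for the simple isogeny factors of `A`, so that there exists an isogeny
  `A₁^{r₁} × ⋯ × A_s^{r_s} → A` for some `rᵢ > 0`. Any such isogeny induces an isomorphism
  `S(A₁) × ⋯ × S(A_s) → S(A)`".
* §2 p. 648 (p0010 L37–L63), "Simple abelian variety of type I. In this case `E = F`. […] Corresponding to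
  the decomposition `F ⊗_ℚ k = ∏ᵢ Fᵢ` […] there is a decomposition `(V(A), φ) = (V₁, φ₁) ⊕ ⋯ ⊕ (V_t, φ_t)`
  […] Here `φᵢ` is a nondegenerate skew-symmetric form on the `Fᵢ`-vector space `Vᵢ`. Therefore,
  `C(A) = C₁ × ⋯ × C_t`, `Cᵢ = End_{Fᵢ}(Vᵢ) ≈ M_{2g/f}(Fᵢ)` […] Moreover, `S(A) = S₁ × ⋯ × S_t`,
  `Sᵢ = Res_{Fᵢ/k} Sp(φᵢ)`"; p. 649 (p0011 L26–L31): over `k^{al}`, "`S(A)_{k^{al}} = ∏_{σ : F → k^{al}} Sp(φ_σ)`".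
  (`GL₂`-type: `f = [F : ℚ] = g = dim A`, so `2g/f = 2` and every `Sp(φ_σ)` is `Sp₂ = SL₂`.)
* Prop. 3.4 (p. 653): "`H^*(A^r)^{S(A)} = k[H²(A^r)^{S(A)}]`"; p. 656 (p0018 L14–L40), "Completion of the proof of
  Proposition 3.4. […] `H^*(A^r) = ⋀^*(rH)` […] the explicit description of `S_σ` and its representation on
  `H_σ`, together with Proposition 3.6, show that each of the `k`-algebras `(⋀^* rH_σ)^{S_σ}` is generated by
  tensors of degree 2"; Prop. 3.6 (a) (p. 655): "`(⋀^*(rH))^G = k[(⊗² rH)^G]` all `r ≥ 1` […] (a) `G = Sp(φ)`".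
* Prop. 3.3 (p. 653): "`H²(A)^{S(A)} = NS(A) ⊗ k`"; Cor. 4.5 (p. 659): "`H^{2*}(A^r)(*)^{L(A)} = D_hom(A^r)_k`";
  Cor. 4.7 (`L(A^r) = L(A)`); Prop. 4.8 (p. 660).

## What is proved (complex `A`, Betti cohomology, the tree's carriers)

DATA as in `SpecialLefschetzGroupInvariantsRealMultiplication` (`φ ∈ End(A)` with `φ^*` diagonalisable on
`H¹(A(ℂ); ℂ)`, `C(A) ⊗ ℂ = centralizerAlgebra A` the commutant of `φ^*`, a rational class `h` with a Kähler
multiple for which `φ^*` is `Q_h`-self-adjoint) PLUS the `GL₂`-type condition `dim_ℂ ker(φ^* − μ) ≤ 2` for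
every `μ` (each `H_σ` is a symplectic plane, `S(A)(ℂ) = ∏_σ SL₂`; e.g. `End⁰(A) = F` totally real of degree
`dim A`, `φ` a generator — RM abelian surfaces, abelian varieties attached to newforms). For every `N`,
with `A^{N+1} = A.powSucc N` and Milne's product class `Σᵢ prᵢ^* h = powPolarizationClass A h N`:

* **`mem_divisorClassesSpan_powSucc_of_forall_exteriorPullback_eq_of_selfAdjoint`** — the `S(ℂ)`-form of
  Cor. 4.5 on `A^{N+1}`: every class of `H^{2p}(A^{N+1}(ℂ); ℂ)` fixed by `⋀^{2p}u` for all
  `u ∈ S(A^{N+1})(ℂ) = unitaryCentralizerGroup (A.powSucc N) (powPolarizationClass A h N)` lies in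
  `Dᵖ(A^{N+1}) ⊗ ℂ`. Proof: the criterion `mem_divisorClassesSpan_of_forall_exteriorPullback_eq_of_colouring`
  of the `Sp₂`-file on the LETTERS `prⱼ^* e_σ, prⱼ^* f_σ` (`(e_σ, f_σ)` a symplectic eigenbasis of `φ^*`,
  `exists_blockSymplecticBasis`; the letters form a basis of `H¹(A^{N+1})`, `mem_span_map_powSlots`), coloured
  by the eigenvalue `σ`; the colour-`σ` torus and transvection are the DIAGONAL images `u^{⊕(N+1)}`
  (`LefschetzCentraliserPowers.diagPow`, in `S(A^{N+1})(ℂ)` by `diagPow_mem_unitaryCentralizerGroup`, acting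
  letter by letter by `diagPow_intertwine_right`) of two elements of `S(A)(ℂ) = ∏_σ Sp₂` (`exists_blockScaling`,
  `exists_blockTransvection`); the crossed classes `prⱼ^*e_σ ⌣ pr_{j'}^*f_σ + pr_{j'}^*e_σ ⌣ prⱼ^*f_σ =
  (prⱼ + pr_{j'})^*θ_σ − prⱼ^*θ_σ − pr_{j'}^*θ_σ`, `θ_σ = e_σ ⌣ f_σ`, are divisor classes
  (`cross_mem_span_rational_oneOne`) because `θ_σ ∈ B¹(A) ⊗ ℂ` — it is fixed by every `u ∈ S(A)(ℂ)`
  (`u` preserves the plane `H_σ` and `Q_h|_{H_σ}`, so `⋀²u θ_σ = det(u|H_σ) θ_σ = θ_σ`) and the `S(A)(ℂ)`-invariants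
  of `H²` are the divisor classes (Prop. 3.3 in the tree's `S(ℂ)`-form
  `mem_hodgeClassSpan_of_forall_exteriorPullback_eq`, `SpecialLefschetzGroupInvariantsHodgeClasses`).
* **`exists_polarization_invariants_le_powSucc_of_selfAdjoint`** — the polarization package of `A^{N+1}`
  (the class `Σᵢ prᵢ^* h` with its three hypotheses, `SpecialLefschetzGroupOneEqUnitaryCentralizer` §Powers).
* **`specialLefschetzGroup_invariants_le_powSucc_of_selfAdjoint`** — the CONCLUSION of the record
  `Milne1999_specialLefschetzGroup_invariants_le` for every power `A^{N+1}`; `…_of_isIsogenous_powSucc_…` for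
  every complex abelian variety isogenous to such a power (Cor. 4.7 / Prop. 1.5); Cor. 4.5 as an equality of
  sets and Prop. 4.8 (c) ⇒ (a) on `A^{N+1}`, hypotheses closed.

Through `SpecialLefschetzGroupInvariantsFiniteProducts` (`exists_polarization_invariants_le_biproduct_of_forall_exists`)
these powers now enter the finite `Hom`-orthogonal products of that file as packaged factors.

NOT here: powers of abelian varieties whose `S(A)(ℂ)` has symplectic blocks of rank `≥ 4`, orthogonal or
general-linear blocks (types I with `[F : ℚ] < dim A`, II, III, IV non-CM): Prop. 3.6 with multiplicity for
`Sp_{2n}` (`n ≥ 2`), `O`, `GL` is not in the tree; the record itself is NOT discharged.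

## References

* [Milne1999LefschetzClasses] J. S. Milne, Lefschetz classes on abelian varieties, Duke Math. J. 96 (1999)
  639–675: §1 pp. 643–644 and Prop. 1.5, §2 pp. 648–649 (type I), Thm. 3.2, Props. 3.3–3.4, 3.6 (a),
  Remark 3.7 (pp. 653–656), Thm. 4.4, Cor. 4.5, Cor. 4.7 (p. 659), Prop. 4.8 (p. 660).
* [GoodmanWallachGTM255] R. Goodman, N. R. Wallach, GTM 255 (2009), §4.1.1, Thm. 5.3.3.
* [LangeBirkenhake1992] H. Lange, Ch. Birkenhake, Complex Abelian Varieties (1992), Lemma 1.1.17, §5.3.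
* [McDuffSalamon2017] D. McDuff, D. Salamon, Introduction to Symplectic Topology, 3rd ed., Thm. 2.1.3.
-/

noncomputable section

open scoped BigOperators
open CategoryTheory
open Literature.AlgebraicTopology.SingularHomology
open Literature.AlgebraicGeometry.HodgeTheory
open Literature.AlgebraicGeometry.Motives
open Literature.AlgebraicGeometry.VanGeemen1994 (pullbackOne hodgeClassSpan)
open Literature.Barriers.HodgeConjecture (divisorClassesSpan divisorMonomials mem_divisorMonomials_zero)
open Literature.Geometry.Kaehler (lefschetzPow)

namespace Literature.AlgebraicGeometry.Milne1999

/-! ### §1 Two more elements of `∏ₖ Sp(V_k)` on a block-symplectic basis: the block scaling and the block transvection -/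

section BlockGroup

variable {V : Type*} [AddCommGroup V] [Module ℂ V] {m : ℕ} {n : Fin m → ℕ} (B : LinearMap.BilinForm ℂ V)
  (b : Module.Basis (Σ k : Fin m, Fin (n k) ⊕ Fin (n k)) ℂ V)
  (h11 : ∀ k (i j : Fin (n k)), B (b ⟨k, Sum.inl i⟩) (b ⟨k, Sum.inl j⟩) = 0)
  (h22 : ∀ k (i j : Fin (n k)), B (b ⟨k, Sum.inr i⟩) (b ⟨k, Sum.inr j⟩) = 0)
  (h12 : ∀ k (i j : Fin (n k)), B (b ⟨k, Sum.inl i⟩) (b ⟨k, Sum.inr j⟩) = if i = j then 1 else 0)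
  (h21 : ∀ k (i j : Fin (n k)), B (b ⟨k, Sum.inr i⟩) (b ⟨k, Sum.inl j⟩) = if i = j then -1 else 0)
  (hcross : ∀ a c, a.1 ≠ c.1 → B (b a) (b c) = 0)
include h11 h22 h12 h21 hcross

/-- **The block scaling of `∏ₖ Sp(V_k)`**: the automorphism `e^{k₀}_i ↦ 2 e^{k₀}_i`, `f^{k₀}_i ↦ 2⁻¹ f^{k₀}_i`
(all `i`), identity on the other blocks, preserves `B` (the element `diag(2, 2⁻¹)` of `Sp(V_{k₀})`, diagonal
in every symplectic pair of the block). [cite: Milne1999LefschetzClasses, §2 p. 648 and §3 Lemma 3.8 (proof)]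
[cite: FultonHarris1991, §16.1] -/
theorem exists_blockScaling (k₀ : Fin m) :
    ∃ u : V ≃ₗ[ℂ] V, (∀ x y, B (u x) (u y) = B x y) ∧
      ∃ d : (Σ k : Fin m, Fin (n k) ⊕ Fin (n k)) → ℂ, (∀ a, u (b a) = d a • b a) ∧
        (∀ k i, d ⟨k, Sum.inl i⟩ = if k = k₀ then 2 else 1) ∧
        (∀ k i, d ⟨k, Sum.inr i⟩ = if k = k₀ then 2⁻¹ else 1) := by
  classical
  let d : (Σ k : Fin m, Fin (n k) ⊕ Fin (n k)) → ℂ := fun a =>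
    if a.1 = k₀ then Sum.elim (fun _ => (2 : ℂ)) (fun _ => 2⁻¹) a.2 else 1
  have hd0 : ∀ a, d a ≠ 0 := by
    rintro ⟨k, i | i⟩ <;> by_cases hk : k = k₀ <;> simp [d, hk]
  have hpair : ∀ a : Σ k : Fin m, Fin (n k) ⊕ Fin (n k), d a * d ⟨a.1, a.2.swap⟩ = 1 := by
    rintro ⟨k, i | i⟩ <;> by_cases hk : k = k₀ <;> simp [d, hk]
  let w : (Σ k : Fin m, Fin (n k) ⊕ Fin (n k)) → ℂˣ := fun a => Units.mk0 (d a) (hd0 a)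
  let u : V ≃ₗ[ℂ] V := b.equiv (b.unitsSMul w) (Equiv.refl _)
  have hd : ∀ a, u (b a) = d a • b a := fun a => by
    simp only [u, w, Module.Basis.equiv_apply, Equiv.refl_apply, Module.Basis.unitsSMul_apply, Units.smul_def,
      Units.val_mk0]
  refine ⟨u, ?_, d, hd, fun k i => ?_, fun k i => ?_⟩
  · have hB : B.comp (u : V →ₗ[ℂ] V) (u : V →ₗ[ℂ] V) = B :=
      LinearMap.BilinForm.ext_basis b fun a c => by
        rw [LinearMap.BilinForm.comp_apply, LinearEquiv.coe_coe, hd, hd, LinearMap.BilinForm.smul_left,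
          LinearMap.BilinForm.smul_right, apply_basis_eq B b h11 h22 h12 h21 hcross]
        by_cases hc : c = ⟨a.1, a.2.swap⟩
        · rw [if_pos hc, hc, ← mul_assoc, hpair, one_mul]
        · rw [if_neg hc, mul_zero, mul_zero]
    intro x y
    have e := congrArg (fun F : LinearMap.BilinForm ℂ V => F x y) hB
    simpa only [LinearMap.BilinForm.comp_apply, LinearEquiv.coe_coe] using e
  · simp [d]
  · simp [d]

omit h22 h21 in
/-- **The block transvection of `∏ₖ Sp(V_k)`**: `u = 1 + N` with `N x = Σᵢ B(e^{k₀}_i, x) e^{k₀}_i`, i.e.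
`e ↦ e` everywhere, `f^{k₀}_i ↦ f^{k₀}_i + e^{k₀}_i`, `f ↦ f` on the other blocks — a product of commuting
symplectic transvections of `Sp(V_{k₀})` (`N` is `B`-skew with isotropic image, `N² = 0`). It preserves `B`
and commutes with every `B`-self-adjoint operator that is scalar on the blocks.
[cite: Milne1999LefschetzClasses, §2 p. 648 (`S_σ = Sp(φ_σ)`)] [cite: GoodmanWallachGTM255, §2.3.2] -/
theorem exists_blockTransvection (hBalt : B.IsAlt) (k₀ : Fin m) :
    ∃ u : V ≃ₗ[ℂ] V, (∀ x y, B (u x) (u y) = B x y) ∧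
      (∀ k i, u (b ⟨k, Sum.inl i⟩) = b ⟨k, Sum.inl i⟩) ∧
      (∀ k i, u (b ⟨k, Sum.inr i⟩) = b ⟨k, Sum.inr i⟩ + if k = k₀ then b ⟨k, Sum.inl i⟩ else 0) ∧
      ∀ (J : Module.End ℂ V) (μ : Fin m → ℂ), (∀ a, J (b a) = μ a.1 • b a) → (∀ x y, B (J x) y = B x (J y)) →
        J * (u : Module.End ℂ V) = (u : Module.End ℂ V) * J := by
  classical
  let e : Fin (n k₀) → V := fun i => b ⟨k₀, Sum.inl i⟩
  let Nm : V →ₗ[ℂ] V := ∑ i, (B (e i)).smulRight (e i)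
  have hN : ∀ x, Nm x = ∑ i, B (e i) x • e i := fun x => by
    simp only [Nm, LinearMap.coe_sum, Finset.sum_apply, LinearMap.smulRight_apply]
  have hee : ∀ i i', B (e i) (e i') = 0 := fun i i' => h11 k₀ i i'
  have hBe : ∀ i x, B (e i) (Nm x) = 0 := by
    intro i x
    rw [hN, map_sum]
    exact Finset.sum_eq_zero fun i' _ => by rw [map_smul, smul_eq_mul, hee, mul_zero]
  have hNN : ∀ x, Nm (Nm x) = 0 := by
    intro x
    rw [hN (Nm x)]
    exact Finset.sum_eq_zero fun i _ => by rw [hBe, zero_smul]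
  have hskew : ∀ x y, B (Nm x) y + B x (Nm y) = 0 := by
    intro x y
    rw [hN x, hN y, LinearMap.BilinForm.sum_left, map_sum]
    rw [← Finset.sum_add_distrib]
    refine Finset.sum_eq_zero fun i _ => ?_
    rw [LinearMap.BilinForm.smul_left, map_smul, smul_eq_mul, ← hBalt.neg_eq x (e i)]
    ring
  have hiso : ∀ x y, B (Nm x) (Nm y) = 0 := by
    intro x y
    rw [hN x, LinearMap.BilinForm.sum_left]
    exact Finset.sum_eq_zero fun i _ => by rw [LinearMap.BilinForm.smul_left, hBe, mul_zero]
  let u : V ≃ₗ[ℂ] V := LinearEquiv.ofLinear (LinearMap.id + Nm) (LinearMap.id - Nm)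
    (by
      refine LinearMap.ext fun x => ?_
      simp only [LinearMap.comp_apply, LinearMap.add_apply, LinearMap.sub_apply, LinearMap.id_apply, map_sub,
        hNN]
      abel)
    (by
      refine LinearMap.ext fun x => ?_
      simp only [LinearMap.comp_apply, LinearMap.add_apply, LinearMap.sub_apply, LinearMap.id_apply, map_add,
        hNN]
      abel)
  have hu : ∀ x, u x = x + Nm x := fun x => rfl
  -- `N` on the basis
  have hNinl : ∀ k i, Nm (b ⟨k, Sum.inl i⟩) = 0 := by
    intro k i
    rw [hN]
    refine Finset.sum_eq_zero fun i' _ => ?_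
    by_cases hk : k₀ = k
    · subst hk; rw [show e i' = b ⟨k₀, Sum.inl i'⟩ from rfl, h11, zero_smul]
    · rw [show e i' = b ⟨k₀, Sum.inl i'⟩ from rfl, hcross _ _ hk, zero_smul]
  have hNinr : ∀ k i, Nm (b ⟨k, Sum.inr i⟩) = if k = k₀ then b ⟨k, Sum.inl i⟩ else 0 := by
    intro k i
    rw [hN]
    by_cases hk : k = k₀
    · subst hk
      rw [if_pos rfl, Finset.sum_eq_single i]
      · rw [show e i = b ⟨k, Sum.inl i⟩ from rfl, h12, if_pos rfl, one_smul]
      · intro i' _ hi'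
        rw [show e i' = b ⟨k, Sum.inl i'⟩ from rfl, h12, if_neg hi', zero_smul]
      · intro h; exact absurd (Finset.mem_univ i) h
    · rw [if_neg hk]
      exact Finset.sum_eq_zero fun i' _ => by
        rw [show e i' = b ⟨k₀, Sum.inl i'⟩ from rfl, hcross _ _ (Ne.symm hk), zero_smul]
  refine ⟨u, fun x y => ?_, fun k i => ?_, fun k i => ?_, fun J μ hJ hJB => ?_⟩
  · rw [hu, hu, map_add B, LinearMap.add_apply, map_add, map_add, hiso, add_zero,
      add_assoc, add_comm (B x (Nm y)), hskew, add_zero]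
  · rw [hu, hNinl, add_zero]
  · rw [hu, hNinr]
  · refine LinearMap.ext fun x => ?_
    rw [Module.End.mul_apply, Module.End.mul_apply, LinearEquiv.coe_coe, hu, hu, map_add, hN, hN, map_sum]
    congr 1
    refine Finset.sum_congr rfl fun i _ => ?_
    rw [map_smul, show e i = b ⟨k₀, Sum.inl i⟩ from rfl, hJ, smul_smul, ← hJB, hJ, LinearMap.BilinForm.smul_left,
      mul_comm]

end BlockGroup

/-! ### §2 Blocks of a block basis inside eigenspaces of bounded dimension -/

section BlockDim

variable {V : Type*} [AddCommGroup V] [Module ℂ V] {m : ℕ} {n : Fin m → ℕ}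

/-- If the block basis diagonalises `J` with block `k` inside `ker(J − μ_k)` and every eigenspace of `J` has
dimension `≤ r`, then `2 n_k ≤ r`. [cite: Milne1999LefschetzClasses, §2 p. 648 (`Cᵢ ≈ M_{2g/f}(Fᵢ)`)] -/
theorem two_mul_blockSize_le_of_finrank_eigenspace_le (b : Module.Basis (Σ k : Fin m, Fin (n k) ⊕ Fin (n k)) ℂ V)
    (J : Module.End ℂ V) {μ : Fin m → ℂ} (hJ : ∀ a, J (b a) = μ a.1 • b a) {r : ℕ}
    (hr : ∀ ν, Module.finrank ℂ (J.eigenspace ν) ≤ r) (k : Fin m) : n k + n k ≤ r := by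
  classical
  haveI : Module.Finite ℂ V := Module.Finite.of_basis b
  set W := J.eigenspace (μ k) with hW
  have hmem : ∀ x : Fin (n k) ⊕ Fin (n k), b ⟨k, x⟩ ∈ W := fun x => Module.End.mem_eigenspace_iff.2 (hJ ⟨k, x⟩)
  let v : Fin (n k) ⊕ Fin (n k) → W := fun x => ⟨b ⟨k, x⟩, hmem x⟩
  have hv : LinearIndependent ℂ v := by
    refine LinearIndependent.of_comp W.subtype ?_
    exact b.linearIndependent.comp (fun x : Fin (n k) ⊕ Fin (n k) => (⟨k, x⟩ : Σ k : Fin m, Fin (n k) ⊕ Fin (n k)))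
      fun x x' hxx' => by cases hxx'; rfl
  have hle := hv.fintype_card_le_finrank
  rw [Fintype.card_sum, Fintype.card_fin] at hle
  exact hle.trans (hr _)

end BlockDim

/-! ### §3 `H¹` of the powers `A^{N+1}`: the letters `prⱼ^* v`; crossed classes of divisor classes -/

section Powers

variable (A : AbelianVariety ℂ)

/-- **Künneth in degree one along a product, for families of homomorphisms to a fixed `T`**: if `H¹(B₁)`
is spanned by the `(g₁ i)^* H¹(T)` and `H¹(B₂)` by the `(g₂ j)^* H¹(T)`, then `H¹(B₁ × B₂)` is spanned by the
pull-backs along the appended family composed with the two projections (the tree's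
`exists_eq_map_fst_add_map_snd_deg_one`; the argument of `HodgeTheory.EllSlots.prod`, without its dimension
clause). [cite: HatcherAT2002, §3.2 Thm. 3.16] [cite: LangeBirkenhake1992, Thm. 4.2.1] -/
theorem mem_span_map_append_prod {T B₁ B₂ : AbelianVariety ℂ} {n₁ n₂ : ℕ} {g₁ : Fin n₁ → (B₁ ⟶ T)}
    {g₂ : Fin n₂ → (B₂ ⟶ T)}
    (hB₁ : ∀ x : complexBetti B₁.X 1, x ∈ Submodule.span ℂ (Set.range fun p : Fin n₁ × complexBetti T.X 1 =>
      complexBetti.map (g₁ p.1).hom.hom.hom 1 p.2))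
    (hB₂ : ∀ x : complexBetti B₂.X 1, x ∈ Submodule.span ℂ (Set.range fun p : Fin n₂ × complexBetti T.X 1 =>
      complexBetti.map (g₂ p.1).hom.hom.hom 1 p.2))
    (x : complexBetti (B₁.prod B₂).X 1) :
    x ∈ Submodule.span ℂ (Set.range fun p : Fin (n₁ + n₂) × complexBetti T.X 1 =>
      complexBetti.map ((Fin.append (fun i => AbelianVariety.fst B₁ B₂ ≫ g₁ i)
        (fun j => AbelianVariety.snd B₁ B₂ ≫ g₂ j)) p.1).hom.hom.hom 1 p.2) := by
  have hAs : IsSmoothProjective B₁.dim B₁.X := AbelianVariety.isSmoothProjective_holds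
  have hBs : IsSmoothProjective B₂.dim B₂.X := AbelianVariety.isSmoothProjective_holds
  obtain ⟨a, c, hab⟩ := exists_eq_map_fst_add_map_snd_deg_one hAs hBs x
  change x = complexBetti.map (AbelianVariety.fst B₁ B₂).hom.hom.hom 1 a +
    complexBetti.map (AbelianVariety.snd B₁ B₂).hom.hom.hom 1 c at hab
  set S := Submodule.span ℂ (Set.range fun p : Fin (n₁ + n₂) × complexBetti T.X 1 =>
    complexBetti.map ((Fin.append (fun i => AbelianVariety.fst B₁ B₂ ≫ g₁ i)
      (fun j => AbelianVariety.snd B₁ B₂ ≫ g₂ j)) p.1).hom.hom.hom 1 p.2) with hS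
  rw [hab]
  refine Submodule.add_mem _ ?_ ?_
  · have hle : Submodule.span ℂ (Set.range fun p : Fin n₁ × complexBetti T.X 1 =>
        complexBetti.map (g₁ p.1).hom.hom.hom 1 p.2) ≤
        S.comap (complexBetti.map (AbelianVariety.fst B₁ B₂).hom.hom.hom 1).hom := by
      refine Submodule.span_le.2 ?_
      rintro _ ⟨⟨i, v⟩, rfl⟩
      refine Submodule.subset_span ⟨(Fin.castAdd n₂ i, v), ?_⟩
      change complexBetti.map ((Fin.append (fun i => AbelianVariety.fst B₁ B₂ ≫ g₁ i)
        (fun j => AbelianVariety.snd B₁ B₂ ≫ g₂ j)) (Fin.castAdd n₂ i)).hom.hom.hom 1 v =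
        complexBetti.map (AbelianVariety.fst B₁ B₂).hom.hom.hom 1 (complexBetti.map (g₁ i).hom.hom.hom 1 v)
      rw [Fin.append_left, complexBetti_map_map_hom]
    exact hle (hB₁ a)
  · have hle : Submodule.span ℂ (Set.range fun p : Fin n₂ × complexBetti T.X 1 =>
        complexBetti.map (g₂ p.1).hom.hom.hom 1 p.2) ≤
        S.comap (complexBetti.map (AbelianVariety.snd B₁ B₂).hom.hom.hom 1).hom := by
      refine Submodule.span_le.2 ?_
      rintro _ ⟨⟨j, v⟩, rfl⟩
      refine Submodule.subset_span ⟨(Fin.natAdd n₁ j, v), ?_⟩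
      change complexBetti.map ((Fin.append (fun i => AbelianVariety.fst B₁ B₂ ≫ g₁ i)
        (fun j => AbelianVariety.snd B₁ B₂ ≫ g₂ j)) (Fin.natAdd n₁ j)).hom.hom.hom 1 v =
        complexBetti.map (AbelianVariety.snd B₁ B₂).hom.hom.hom 1 (complexBetti.map (g₂ j).hom.hom.hom 1 v)
      rw [Fin.append_right, complexBetti_map_map_hom]
    exact hle (hB₂ c)

/-- `H¹(A)` is spanned by the pull-backs along the one-member family `(𝟙_A)`. [cite: HatcherAT2002, §3.2 Thm. 3.16] -/
theorem mem_span_map_id_one (x : complexBetti A.X 1) :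
    x ∈ Submodule.span ℂ (Set.range fun p : Fin 1 × complexBetti A.X 1 =>
      complexBetti.map ((![𝟙 A] : Fin 1 → (A ⟶ A)) p.1).hom.hom.hom 1 p.2) := by
  refine Submodule.subset_span ⟨((0 : Fin 1), x), ?_⟩
  change complexBetti.map (𝟙 A.X) 1 x = x
  rw [complexBetti.map_id]
  rfl

/-- **`H¹(A^{N+1}) = Σⱼ prⱼ^* H¹(A)`** for the projections `prⱼ = HodgeTheory.powSlots A N j` of the power
`A.powSucc N` (Milne §1 p. 643: "`V(A^r) = rV(A)`"). [cite: Milne1999LefschetzClasses, §1 p. 643]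
[cite: HatcherAT2002, §3.2 Thm. 3.16] -/
theorem mem_span_map_powSlots : ∀ (N : ℕ) (x : complexBetti (A.powSucc N).X 1),
    x ∈ Submodule.span ℂ (Set.range fun p : Fin (N + 1) × complexBetti A.X 1 =>
      complexBetti.map (powSlots A N p.1).hom.hom.hom 1 p.2)
  | 0, x => mem_span_map_id_one A x
  | N + 1, x => mem_span_map_append_prod (mem_span_map_powSlots N) (mem_span_map_id_one A) x

/-- `dim A^{N+1} = (N + 1) dim A`. [cite: LangeBirkenhake1992, §1.2] -/
theorem dim_powSucc_eq_succ_mul : ∀ N : ℕ, (A.powSucc N).dim = (N + 1) * A.dim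
  | 0 => by rw [zero_add, one_mul]; rfl
  | N + 1 => by
    rw [show A.powSucc (N + 1) = (A.powSucc N).prod A from rfl, AbelianVariety.dim_prod, dim_powSucc_eq_succ_mul N]
    ring

variable {A}

/-- **Crossed classes of a divisor class are divisor classes**: for homomorphisms `g, g' : T → A` and degree-one
classes `e, f` of `A` with `e ⌣ f ∈ B¹(A) ⊗ ℂ`, the class `g^*e ⌣ g'^*f + g'^*e ⌣ g^*f =
(g + g')^*(e ⌣ f) − g^*(e ⌣ f) − g'^*(e ⌣ f)` lies in `B¹(T) ⊗ ℂ` (pull-back is additive on `H¹` for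
homomorphisms of abelian varieties and multiplicative; the tree's `slotLetters_cross_mem_span_rational_oneOne`
for an elliptic curve, with the divisor hypothesis made explicit). These are Milne's degree-`2` invariants on
`A^r` pairing two copies (Prop. 3.3 for `A × A`: graph classes of `Hom`).
[cite: Milne1999LefschetzClasses, Prop. 3.3 and Lemma 3.1] [cite: HatcherAT2002, §3.2 Prop. 3.10] -/
theorem cross_mem_span_rational_oneOne {T : AbelianVariety ℂ} (g g' : T ⟶ A) (e f : complexBetti A.X 1)
    (hθ : cupProduct (rfl : 1 + 1 = 2) e f ∈
      Submodule.span ℂ {c : complexBetti A.X 2 | IsRationalClass c ∧ IsOfHodgeType A.dim A.X 2 1 1 c}) :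
    cupProduct (rfl : 1 + 1 = 2) (complexBetti.map g.hom.hom.hom 1 e) (complexBetti.map g'.hom.hom.hom 1 f) +
        cupProduct (rfl : 1 + 1 = 2) (complexBetti.map g'.hom.hom.hom 1 e) (complexBetti.map g.hom.hom.hom 1 f) ∈
      Submodule.span ℂ {c : complexBetti T.X 2 | IsRationalClass c ∧ IsOfHodgeType T.dim T.X 2 1 1 c} := by
  have hT : IsSmoothProjective T.dim T.X := AbelianVariety.isSmoothProjective_holds
  have hAs : IsSmoothProjective A.dim A.X := AbelianVariety.isSmoothProjective_holds
  set θ : complexBetti A.X 2 := cupProduct (rfl : 1 + 1 = 2) e f with hθdef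
  have hpull : ∀ ψ : T ⟶ A, complexBetti.map ψ.hom.hom.hom 2 θ =
      cupProduct (rfl : 1 + 1 = 2) (complexBetti.map ψ.hom.hom.hom 1 e) (complexBetti.map ψ.hom.hom.hom 1 f) :=
    fun ψ => complexBetti.map_cupProduct _ _ _ _
  have key : cupProduct (rfl : 1 + 1 = 2) (complexBetti.map g.hom.hom.hom 1 e) (complexBetti.map g'.hom.hom.hom 1 f) +
        cupProduct (rfl : 1 + 1 = 2) (complexBetti.map g'.hom.hom.hom 1 e) (complexBetti.map g.hom.hom.hom 1 f) =
      complexBetti.map (g + g').hom.hom.hom 2 θ - complexBetti.map g.hom.hom.hom 2 θ -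
        complexBetti.map g'.hom.hom.hom 2 θ := by
    have hadd : ∀ v : complexBetti A.X 1, complexBetti.map (g + g').hom.hom.hom 1 v =
        complexBetti.map g.hom.hom.hom 1 v + complexBetti.map g'.hom.hom.hom 1 v :=
      fun v => complexBetti_map_add_deg_one g g' v
    simp only [hpull, hadd, map_add, LinearMap.add_apply]
    abel
  rw [key]
  exact Submodule.sub_mem _ (Submodule.sub_mem _ (map_mem_span_rational_oneOne hT hAs _ hθ)
    (map_mem_span_rational_oneOne hT hAs _ hθ)) (map_mem_span_rational_oneOne hT hAs _ hθ)

end Powers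

/-! ### §4 A plane preserved with its symplectic form: `⋀²u` fixes `e ⌣ f` -/

section Plane

variable {A : AbelianVariety ℂ}

/-- **`⋀²u (e ⌣ f) = e ⌣ f` for an automorphism `u` of `H¹` preserving the plane `⟨e, f⟩` and an alternating
form `B` with `B(e, f) = 1`** (`⋀²u` acts on the line `⋀²⟨e, f⟩` by `det(u|⟨e,f⟩) = 1`). [cite: Milne1999LefschetzClasses, §2 p. 648 (`S_σ = Sp(φ_σ)`)]
[cite: LangeBirkenhake1992, Lemma 1.1.17] -/
theorem exteriorPullback_cupProduct_eq_self_of_plane (B : LinearMap.BilinForm ℂ (complexBetti A.X 1))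
    (hBalt : B.IsAlt) {e f : complexBetti A.X 1} (hef : B e f = 1)
    (u : complexBetti A.X 1 ≃ₗ[ℂ] complexBetti A.X 1) (huB : ∀ x y, B (u x) (u y) = B x y)
    (hue : u e ∈ Submodule.span ℂ ({e, f} : Set (complexBetti A.X 1)))
    (huf : u f ∈ Submodule.span ℂ ({e, f} : Set (complexBetti A.X 1))) :
    exteriorPullback (AbelianVariety.hasExteriorCohomologyH1_complexPoints A)
        (u : complexBetti A.X 1 →ₗ[ℂ] complexBetti A.X 1) 2 (cupProduct (rfl : 1 + 1 = 2) e f) =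
      cupProduct (rfl : 1 + 1 = 2) e f := by
  have hX := AbelianVariety.hasExteriorCohomologyH1_complexPoints A
  obtain ⟨α, γ, hue'⟩ := Submodule.mem_span_pair.1 hue
  obtain ⟨β, δ, huf'⟩ := Submodule.mem_span_pair.1 huf
  -- `det = 1` from `B(ue, uf) = B(e, f) = 1`
  have hfe : B f e = -1 := by rw [← hBalt.neg_eq, hef]
  have hdet : α * δ - γ * β = 1 := by
    have e1 := huB e f
    rw [← hue', ← huf', hef] at e1
    simp only [map_add, map_smul, LinearMap.add_apply, LinearMap.smul_apply, smul_eq_mul, hBalt e, hBalt f,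
      hef, hfe] at e1
    linear_combination e1
  -- `⋀²u (e ⌣ f) = ue ⌣ uf`
  have h1 : exteriorPullback hX (u : complexBetti A.X 1 →ₗ[ℂ] complexBetti A.X 1) 2 (cupProduct (rfl : 1 + 1 = 2) e f) =
      cupProduct (rfl : 1 + 1 = 2) (u e) (u f) := by
    rw [exteriorPullback_cupProduct_one_one A hX]
    rfl
  have hff : cupProduct (rfl : 1 + 1 = 2) f f = 0 := cup_self_deg_one f
  have hee : cupProduct (rfl : 1 + 1 = 2) e e = 0 := cup_self_deg_one e
  have hfe' : cupProduct (rfl : 1 + 1 = 2) f e = -cupProduct (rfl : 1 + 1 = 2) e f := by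
    rw [cupProduct_gradedComm_holds ℂ (ComplexPoints A.X) (rfl : 1 + 1 = 2) rfl f e]
    simp
  rw [h1, ← hue', ← huf']
  simp only [map_add, map_smul, LinearMap.add_apply, LinearMap.smul_apply, hee, hff, hfe', smul_zero, zero_add,
    add_zero, smul_neg, smul_smul]
  have hc : -(β * γ) + δ * α = 1 := by linear_combination hdet
  calc -((β * γ) • cupProduct (rfl : 1 + 1 = 2) e f) + (δ * α) • cupProduct (rfl : 1 + 1 = 2) e f
      = (-(β * γ) + δ * α) • cupProduct (rfl : 1 + 1 = 2) e f := by rw [add_smul, neg_smul]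
    _ = cupProduct (rfl : 1 + 1 = 2) e f := by rw [hc, one_smul]

/-- On a block basis, an eigenspace of dimension `≤ 2` containing a symplectic pair IS the plane of that pair.
[cite: Milne1999LefschetzClasses, §2 p. 648 (`Cᵢ ≈ M_{2g/f}(Fᵢ)`)] -/
theorem eigenspace_eq_span_pair {V : Type*} [AddCommGroup V] [Module ℂ V] {m : ℕ} {n : Fin m → ℕ}
    (b : Module.Basis (Σ k : Fin m, Fin (n k) ⊕ Fin (n k)) ℂ V) (J : Module.End ℂ V) {μ : Fin m → ℂ}
    (hJ : ∀ a, J (b a) = μ a.1 • b a) (k : Fin m) (i : Fin (n k))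
    (h2 : Module.finrank ℂ (J.eigenspace (μ k)) ≤ 2) :
    J.eigenspace (μ k) = Submodule.span ℂ {b ⟨k, Sum.inl i⟩, b ⟨k, Sum.inr i⟩} := by
  classical
  haveI : Module.Finite ℂ V := Module.Finite.of_basis b
  have hli : LinearIndependent ℂ ![b ⟨k, Sum.inl i⟩, b ⟨k, Sum.inr i⟩] := by
    refine (LinearIndependent.pair_iff' (b.ne_zero _)).2 fun c hc => ?_
    have e := congrArg (fun v => b.repr v ⟨k, Sum.inr i⟩) hc
    simp at e
  symm
  refine Submodule.eq_of_le_of_finrank_le ?_ ?_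
  · rw [Submodule.span_le]
    intro v hv
    rcases hv with hv | hv
    · rw [hv]; exact Module.End.mem_eigenspace_iff.2 (hJ _)
    · rw [Set.mem_singleton_iff] at hv
      rw [hv]; exact Module.End.mem_eigenspace_iff.2 (hJ _)
  · refine h2.trans ?_
    have e2 := finrank_span_eq_card hli
    have hrange : Set.range ![b ⟨k, Sum.inl i⟩, b ⟨k, Sum.inr i⟩] = {b ⟨k, Sum.inl i⟩, b ⟨k, Sum.inr i⟩} := by
      rw [Matrix.range_cons, Matrix.range_cons, Matrix.range_empty, Set.union_empty]
      rfl
    rw [hrange] at e2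
    rw [e2]
    simp

/-- **`⋀²u` fixes `e^k_i ⌣ f^k_i` for every `u` commuting with the block-scalar `J` and preserving `B`, when the
eigenspace of block `k` has dimension `≤ 2`** (`u` preserves the plane `⟨e^k_i, f^k_i⟩ = ker(J − μ_k)` and the
symplectic form on it: determinant one). [cite: Milne1999LefschetzClasses, §2 p. 648 (`S_σ = Sp(φ_σ)`)]
[cite: LangeBirkenhake1992, Lemma 1.1.17] -/
theorem exteriorPullback_cupProduct_block_eq_self {m : ℕ} {n : Fin m → ℕ} (B : LinearMap.BilinForm ℂ (complexBetti A.X 1))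
    (hBalt : B.IsAlt) (b : Module.Basis (Σ k : Fin m, Fin (n k) ⊕ Fin (n k)) ℂ (complexBetti A.X 1))
    (h12 : ∀ k (i j : Fin (n k)), B (b ⟨k, Sum.inl i⟩) (b ⟨k, Sum.inr j⟩) = if i = j then 1 else 0)
    (J : Module.End ℂ (complexBetti A.X 1)) {μ : Fin m → ℂ} (hJ : ∀ a, J (b a) = μ a.1 • b a)
    (k : Fin m) (i : Fin (n k)) (h2 : Module.finrank ℂ (J.eigenspace (μ k)) ≤ 2)
    (u : complexBetti A.X 1 ≃ₗ[ℂ] complexBetti A.X 1) (huJ : ∀ v, J (u v) = u (J v))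
    (huB : ∀ x y, B (u x) (u y) = B x y) :
    exteriorPullback (AbelianVariety.hasExteriorCohomologyH1_complexPoints A)
        (u : complexBetti A.X 1 →ₗ[ℂ] complexBetti A.X 1) 2
        (cupProduct (rfl : 1 + 1 = 2) (b ⟨k, Sum.inl i⟩) (b ⟨k, Sum.inr i⟩)) =
      cupProduct (rfl : 1 + 1 = 2) (b ⟨k, Sum.inl i⟩) (b ⟨k, Sum.inr i⟩) := by
  have hplane := eigenspace_eq_span_pair b J hJ k i h2
  have hpres : ∀ v ∈ Module.End.eigenspace J (μ k), u v ∈ Module.End.eigenspace J (μ k) := by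
    intro v hv
    rw [Module.End.mem_eigenspace_iff] at hv ⊢
    rw [huJ, hv, map_smul]
  have hue := hpres _ (Module.End.mem_eigenspace_iff.2 (hJ ⟨k, Sum.inl i⟩))
  have huf := hpres _ (Module.End.mem_eigenspace_iff.2 (hJ ⟨k, Sum.inr i⟩))
  rw [hplane] at hue huf
  have hef : B (b ⟨k, Sum.inl i⟩) (b ⟨k, Sum.inr i⟩) = 1 := by rw [h12, if_pos rfl]
  exact exteriorPullback_cupProduct_eq_self_of_plane B hBalt hef u huB hue huf

end Plane

/-! ### §5 The `S(ℂ)`-form of Cor. 4.5 on the powers `A^{N+1}` of a `GL₂`-type abelian variety with real multiplication -/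

section Main

variable {A : AbelianVariety ℂ}

/-- **Milne 1999, Cor. 4.5 / Thm. 3.2 / Prop. 3.6 (a) with multiplicity, `S(ℂ)`-form on the powers of a
`GL₂`-type abelian variety with real multiplication.** Let `A` be a complex abelian variety with
`φ ∈ End(A)` such that `φ^*` is diagonalisable on `H¹(A(ℂ); ℂ)` with eigenspaces of dimension `≤ 2`,
`C(A) ⊗ ℂ` is the commutant of `φ^*`, and `φ^*` is `Q_h`-self-adjoint for a rational class `h` with a Kähler
multiple (so `S(A)(ℂ) = ∏_σ Sp(H_σ) = ∏_σ SL₂`: Milne §2, type I with `[F : ℚ] = dim A`). Then for every `N`,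
every class of `H^{2p}(A^{N+1}(ℂ); ℂ)` fixed by `⋀^{2p}u` for all
`u ∈ S(A^{N+1})(ℂ) = unitaryCentralizerGroup (A.powSucc N) (Σᵢ prᵢ^* h)` lies in `Dᵖ(A^{N+1}) ⊗ ℂ`
("each of the `k`-algebras `(⋀^* rH_σ)^{S_σ}` is generated by tensors of degree 2", `r = N + 1`). Proof in
the module docstring: the `Sp₂`-with-multiplicity criterion on the letters `prⱼ^* e_σ, prⱼ^* f_σ`, the
diagonal torus/transvection of each colour, and `e_σ ⌣ f_σ ∈ B¹(A) ⊗ ℂ` by Prop. 3.3.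
[cite: Milne1999LefschetzClasses, §1 p. 643, §2 p. 648, Props. 3.3–3.4, 3.6 (a), p. 656, Cor. 4.5 (p. 659)]
[cite: GoodmanWallachGTM255, Thm. 5.3.3] -/
theorem mem_divisorClassesSpan_powSucc_of_forall_exteriorPullback_eq_of_selfAdjoint (φ : A ⟶ A)
    (hC : centralizerAlgebra A = Subalgebra.centralizer ℂ {pullbackOne A φ})
    (hdiag : ⨆ μ : ℂ, Module.End.eigenspace (pullbackOne A φ) μ = ⊤)
    (h2 : ∀ μ : ℂ, Module.finrank ℂ (Module.End.eigenspace (pullbackOne A φ) μ) ≤ 2)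
    {h : complexBetti A.X 2} (hQ : IsRationalClass h)
    (hK : ∃ s : ℝ, 0 < s ∧ IsKaehlerClass A.dim A.X ((s : ℂ) • h))
    (hJQ : ∀ x y : complexBetti A.X 1,
      polarizationPairingOne A.X h (A.dim - 1) (pullbackOne A φ x) y =
        polarizationPairingOne A.X h (A.dim - 1) x (pullbackOne A φ y))
    (N p : ℕ) (x : complexBetti (A.powSucc N).X (2 * p))
    (hx : ∀ u ∈ unitaryCentralizerGroup (A.powSucc N) (powPolarizationClass A h N),
      exteriorPullback (AbelianVariety.hasExteriorCohomologyH1_complexPoints (A.powSucc N))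
        (u : complexBetti (A.powSucc N).X 1 →ₗ[ℂ] complexBetti (A.powSucc N).X 1) (2 * p) x = x) :
    x ∈ divisorClassesSpan (A.powSucc N).X (A.powSucc N).dim p := by
  classical
  haveI : Module.Finite ℂ (complexBetti A.X 1) := abelianVarietyCohomologyExteriorH1_holds.finite_one A
  haveI : Module.Finite ℂ (complexBetti (A.powSucc N).X 1) :=
    abelianVarietyCohomologyExteriorH1_holds.finite_one (A.powSucc N)
  have hX := AbelianVariety.hasExteriorCohomologyH1_complexPoints (A.powSucc N)
  -- degree `0`: everything is a multiple of the unit class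
  rcases Nat.eq_zero_or_pos p with rfl | hp1
  · have htop : Submodule.span ℂ (Set.range (cupPowOne ℂ (ComplexPoints (A.powSucc N).X) 0)) = ⊤ :=
      hX.span_range_cupPowOne 0
    have hrange : Set.range (cupPowOne ℂ (ComplexPoints (A.powSucc N).X) 0) =
        {singularCohomology.one ℂ (ComplexPoints (A.powSucc N).X)} := by
      ext c
      simp only [Set.mem_range, cupPowOne_zero, Set.mem_singleton_iff]
      exact ⟨fun ⟨_, e⟩ => e.symm, fun e => ⟨fun i => Fin.elim0 i, e.symm⟩⟩
    have hx' : x ∈ Submodule.span ℂ (Set.range (cupPowOne ℂ (ComplexPoints (A.powSucc N).X) 0)) := by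
      rw [htop]; exact Submodule.mem_top
    rw [hrange] at hx'
    refine Submodule.span_mono (fun c hc => ?_) hx'
    rw [Set.mem_singleton_iff] at hc
    exact mem_divisorMonomials_zero.2 hc
  -- dimension `0`: no classes in positive degree
  rcases Nat.eq_zero_or_pos A.dim with hA | hA0
  · haveI : Subsingleton (complexBetti (A.powSucc N).X (2 * p)) :=
      hX.subsingleton_of_lt (by rw [AbelianVariety.finrank_complexBetti_one, dim_powSucc_eq_succ_mul, hA]; omega)
    rw [Subsingleton.elim x 0]
    exact Submodule.zero_mem _
  -- the polarization data of `A`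
  obtain ⟨s, hs, hKs⟩ := hK
  have hnd := eq_zero_of_forall_polarizationPairingOne_eq_zero_of_isKaehlerClass_smul' hs.ne' hKs
  have hh : h ∈ hodgeClassSpan A.dim A.X 1 := mem_hodgeClassSpan_one_of_isKaehlerClass_smul hQ hs.ne' hKs
  obtain ⟨Bf, hBalt, hBnd, lam, hlam, hBapp⟩ := exists_bilinForm_isAlt_nondegenerate (A := A) hnd
  set J : Module.End ℂ (complexBetti A.X 1) := pullbackOne A φ with hJ_def
  have hJB : ∀ x y, Bf (J x) y = Bf x (J y) := fun x y => by rw [hBapp, hBapp, hJ_def, hJQ]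
  -- the block-symplectic eigenbasis; blocks of size `≤ 1`
  obtain ⟨m, n, μ, b₁, hμ, hJb, hcr, h11, h22, h12⟩ := exists_blockSymplecticBasis Bf hBalt hBnd J hdiag hJB
  have h21 : ∀ k (i j : Fin (n k)), Bf (b₁ ⟨k, Sum.inr i⟩) (b₁ ⟨k, Sum.inl j⟩) = if i = j then -1 else 0 := by
    intro k i j
    rw [← hBalt.neg_eq, h12]
    by_cases hij : i = j
    · subst hij; simp
    · rw [if_neg (Ne.symm hij), if_neg hij, neg_zero]
  have hn1 : ∀ k, n k ≤ 1 := fun k => by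
    have := two_mul_blockSize_le_of_finrank_eigenspace_le b₁ J hJb h2 k
    omega
  -- membership in `S(A)(ℂ)`: commute with `J` (hence with `End(A)`, by `hC`) and preserve `Bf`
  have hmem : ∀ u : complexBetti A.X 1 ≃ₗ[ℂ] complexBetti A.X 1,
      J * (u : Module.End ℂ (complexBetti A.X 1)) = (u : Module.End ℂ (complexBetti A.X 1)) * J →
      (∀ a c, Bf (u a) (u c) = Bf a c) → u ∈ unitaryCentralizerGroup A h := by
    intro u hcomm hu
    refine ⟨mem_centralizerGroup_iff_coe_mem.2 ?_, fun a c => hlam (by rw [← hBapp, ← hBapp, hu a c])⟩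
    rw [hC, Subalgebra.mem_centralizer_iff]
    intro g hg
    rw [Set.mem_singleton_iff] at hg
    rw [hg]
    exact hcomm
  -- conversely an element of `S(A)(ℂ)` commutes with `J` and preserves `Bf`
  have hofmem : ∀ u ∈ unitaryCentralizerGroup A h,
      (∀ v, J (u v) = u (J v)) ∧ ∀ a c, Bf (u a) (u c) = Bf a c := by
    intro u hu
    refine ⟨fun v => ?_, fun a c => by rw [hBapp, hBapp, hu.2]⟩
    have hc := mem_centralizerGroup_iff_coe_mem.1 hu.1
    rw [hC, Subalgebra.mem_centralizer_iff] at hc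
    have e := hc J (Set.mem_singleton J)
    exact LinearMap.congr_fun e v
  -- the letters of `H¹(A^{N+1})`: `prⱼ^* e_σ`, `prⱼ^* f_σ`
  let v2 : (Σ k : Fin m, Fin (n k)) → Fin 2 → complexBetti A.X 1 := fun σ =>
    ![b₁ ⟨σ.1, Sum.inl σ.2⟩, b₁ ⟨σ.1, Sum.inr σ.2⟩]
  have hv20 : ∀ σ, v2 σ 0 = b₁ ⟨σ.1, Sum.inl σ.2⟩ := fun σ => rfl
  have hv21 : ∀ σ, v2 σ 1 = b₁ ⟨σ.1, Sum.inr σ.2⟩ := fun σ => rfl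
  let y : (Fin (N + 1) × (Σ k : Fin m, Fin (n k))) × Fin 2 → complexBetti (A.powSucc N).X 1 := fun sl =>
    complexBetti.map (powSlots A N sl.1.1).hom.hom.hom 1 (v2 sl.1.2 sl.2)
  have hy : ∀ j σ ℓ, y ((j, σ), ℓ) = complexBetti.map (powSlots A N j).hom.hom.hom 1 (v2 σ ℓ) := fun _ _ _ => rfl
  -- they span `H¹(A^{N+1})`
  have hyspan : ⊤ ≤ Submodule.span ℂ (Set.range y) := by
    intro z _
    have hz := mem_span_map_powSlots A N z
    refine (Submodule.span_le.2 ?_) hz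
    rintro _ ⟨⟨j, v⟩, rfl⟩
    change complexBetti.map (powSlots A N j).hom.hom.hom 1 v ∈ Submodule.span ℂ (Set.range y)
    rw [← b₁.sum_repr v, map_sum]
    refine Submodule.sum_mem _ fun a _ => ?_
    rw [map_smul]
    refine Submodule.smul_mem _ _ (Submodule.subset_span ?_)
    obtain ⟨k, i | i⟩ := a
    · exact ⟨((j, ⟨k, i⟩), 0), rfl⟩
    · exact ⟨((j, ⟨k, i⟩), 1), rfl⟩
  -- and have the right number of members
  have hcard : Fintype.card ((Fin (N + 1) × (Σ k : Fin m, Fin (n k))) × Fin 2) =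
      Module.finrank ℂ (complexBetti (A.powSucc N).X 1) := by
    rw [AbelianVariety.finrank_complexBetti_one, dim_powSucc_eq_succ_mul, ← sum_eq_dim_of_blockBasis b₁]
    simp only [Fintype.card_prod, Fintype.card_fin, Fintype.card_sigma]
    ring
  obtain ⟨bB, hbB⟩ : ∃ bB : Module.Basis ((Fin (N + 1) × (Σ k : Fin m, Fin (n k))) × Fin 2) ℂ
      (complexBetti (A.powSucc N).X 1), ∀ sl, bB sl = y sl :=
    ⟨basisOfTopLeSpanOfCardEqFinrank y hyspan hcard, fun sl => by rw [coe_basisOfTopLeSpanOfCardEqFinrank]⟩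
  -- the colouring by eigenvalue blocks
  let col : Fin (N + 1) × (Σ k : Fin m, Fin (n k)) → Fin m := fun t => t.2.1
  -- THE CRITERION
  refine mem_divisorClassesSpan_of_forall_exteriorPullback_eq_of_colouring bB col
    (unitaryCentralizerGroup (A.powSucc N) (powPolarizationClass A h N))
    (fun k₀ => ?_) (fun k₀ => ?_) (fun t t' htt' => ?_) p x hx
  · -- the torus of colour `k₀`: the diagonal image of the block scaling
    obtain ⟨τ, hτB, d, hτd, hd0, hd1⟩ := exists_blockScaling Bf b₁ h11 h22 h12 h21 hcr k₀
    have hτ : τ ∈ unitaryCentralizerGroup A h := hmem τ (mul_eq_mul_of_blockDiag b₁ J hJb τ hτd) hτB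
    refine ⟨diagPow A τ N, diagPow_mem_unitaryCentralizerGroup hA0 hτ N, fun t => ?_, fun t => ?_⟩
    · obtain ⟨j, σ⟩ := t
      rw [hbB, hy, diagPow_intertwine_right hτ.1, hv20, hτd, hd0, map_smul]
    · obtain ⟨j, σ⟩ := t
      rw [hbB, hy, diagPow_intertwine_right hτ.1, hv21, hτd, hd1, map_smul]
  · -- the transvection of colour `k₀`: the diagonal image of the block transvection
    obtain ⟨ν, hνB, hν0, hν1, hνJ⟩ := exists_blockTransvection Bf b₁ h11 h12 hcr hBalt k₀
    have hν : ν ∈ unitaryCentralizerGroup A h := hmem ν (hνJ J μ hJb hJB) hνB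
    refine ⟨diagPow A ν N, diagPow_mem_unitaryCentralizerGroup hA0 hν N, fun t => ?_, fun t => ?_⟩
    · obtain ⟨j, σ⟩ := t
      rw [hbB, hy, diagPow_intertwine_right hν.1, hv20, hν0]
    · obtain ⟨j, σ⟩ := t
      rw [hbB, hbB, hy, hy, diagPow_intertwine_right hν.1, hv21, hν1, map_add, hv20]
      congr 1
      change complexBetti.map (powSlots A N j).hom.hom.hom 1 (if σ.1 = k₀ then b₁ ⟨σ.1, Sum.inl σ.2⟩ else 0) =
        if σ.1 = k₀ then complexBetti.map (powSlots A N j).hom.hom.hom 1 (b₁ ⟨σ.1, Sum.inl σ.2⟩) else 0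
      split_ifs
      · rfl
      · exact map_zero _
  · -- crossed classes of two slots of the same colour are divisor classes
    obtain ⟨j, k, i⟩ := t
    obtain ⟨j', k', i'⟩ := t'
    change k = k' at htt'
    subst htt'
    have hii' : i = i' := Fin.ext (by have := hn1 k; omega)
    subst hii'
    rw [hbB, hbB, hbB, hbB, hy, hy, hy, hy, hv20, hv21]
    refine cross_mem_span_rational_oneOne (powSlots A N j) (powSlots A N j') _ _ ?_
    -- `θ = e ⌣ f ∈ B¹(A) ⊗ ℂ`: it is fixed by every `u ∈ S(A)(ℂ)` (Prop. 3.3, `S(ℂ)`-form)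
    refine mem_hodgeClassSpan_of_forall_exteriorPullback_eq hh (p := 1) fun u hu => ?_
    obtain ⟨huJ, huB⟩ := hofmem u hu
    exact exteriorPullback_cupProduct_block_eq_self Bf hBalt b₁ h12 J hJb k i (h2 (μ k)) u huJ huB

/-- **The polarization package of every power `A^{N+1}` of a `GL₂`-type abelian variety with real
multiplication** (`0 < dim A`): Milne's class `Σᵢ prᵢ^* h ∈ B¹(A^{N+1}) ⊗ ℂ` with `(Σᵢ prᵢ^* h)^{dim} ≠ 0`,
`Q` non-degenerate (`SpecialLefschetzGroupOneEqUnitaryCentralizer` §Powers) and the `S(ℂ)`-form above — the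
datum consumed by `SpecialLefschetzGroupInvariantsFiniteProducts` (packages of factors ⇒ packages of finite
`Hom`-orthogonal products). [cite: Milne1999LefschetzClasses, §1 p. 643, Prop. 3.4, Cor. 4.5 (p. 659)] -/
theorem exists_polarization_invariants_le_powSucc_of_selfAdjoint (φ : A ⟶ A)
    (hC : centralizerAlgebra A = Subalgebra.centralizer ℂ {pullbackOne A φ})
    (hdiag : ⨆ μ : ℂ, Module.End.eigenspace (pullbackOne A φ) μ = ⊤)
    (h2 : ∀ μ : ℂ, Module.finrank ℂ (Module.End.eigenspace (pullbackOne A φ) μ) ≤ 2)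
    {h : complexBetti A.X 2} (hQ : IsRationalClass h)
    (hK : ∃ s : ℝ, 0 < s ∧ IsKaehlerClass A.dim A.X ((s : ℂ) • h))
    (hJQ : ∀ x y : complexBetti A.X 1,
      polarizationPairingOne A.X h (A.dim - 1) (pullbackOne A φ x) y =
        polarizationPairingOne A.X h (A.dim - 1) x (pullbackOne A φ y))
    (hA0 : 0 < A.dim) (N : ℕ) :
    ∃ D : complexBetti (A.powSucc N).X 2, D ∈ hodgeClassSpan (A.powSucc N).dim (A.powSucc N).X 1 ∧
      lefschetzPow D ((A.powSucc N).dim - 1) 2 D ≠ 0 ∧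
      (∀ z : complexBetti (A.powSucc N).X 1,
        (∀ y, polarizationPairingOne (A.powSucc N).X D ((A.powSucc N).dim - 1) z y = 0) → z = 0) ∧
      ∀ (a : ℕ) (y : complexBetti (A.powSucc N).X (2 * a)), (∀ u ∈ unitaryCentralizerGroup (A.powSucc N) D,
        exteriorPullback (AbelianVariety.hasExteriorCohomologyH1_complexPoints (A.powSucc N))
          (u : complexBetti (A.powSucc N).X 1 →ₗ[ℂ] complexBetti (A.powSucc N).X 1) (2 * a) y = y) →
        y ∈ divisorClassesSpan (A.powSucc N).X (A.powSucc N).dim a := by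
  obtain ⟨s, hs, hKs⟩ := hK
  have hnd := eq_zero_of_forall_polarizationPairingOne_eq_zero_of_isKaehlerClass_smul' hs.ne' hKs
  have hh : h ∈ hodgeClassSpan A.dim A.X 1 := mem_hodgeClassSpan_one_of_isKaehlerClass_smul hQ hs.ne' hKs
  have htop : lefschetzPow h (A.dim - 1) 2 h ≠ 0 := lefschetzPow_self_ne_zero_of_isKaehlerClass_smul hA0 hKs
  exact ⟨powPolarizationClass A h N, powPolarizationClass_mem_hodgeClassSpan hh N,
    lefschetzPow_powPolarizationClass_self_ne_zero hA0 htop N,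
    eq_zero_of_forall_polarizationPairingOne_powPolarizationClass_eq_zero hA0 htop hnd N,
    fun a y hy => mem_divisorClassesSpan_powSucc_of_forall_exteriorPullback_eq_of_selfAdjoint φ hC hdiag h2 hQ
      ⟨s, hs, hKs⟩ hJQ N a y hy⟩

/-- **The conclusion of the record `Milne1999_specialLefschetzGroup_invariants_le` (Milne 1999, Cor. 4.5 with
Thm. 4.4, Thm. 3.2 and Prop. 3.6 (a) WITH MULTIPLICITY) PROVED for every power of a `GL₂`-type abelian variety
with real multiplication**: for `A` as above and every `N`, every class `x ∈ H^{2p}(A^{N+1}(ℂ); ℂ)` fixed by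
every element of `specialLefschetzGroup (dim A^{N+1}) (A^{N+1}).X` lies in `Dᵖ_hom(A^{N+1})_ℂ`
(`A^{N+1} = A.powSucc N`; in dimension `0` there is nothing to prove). [cite: Milne1999LefschetzClasses, Cor. 4.5 and Cor. 4.7 (p. 659), Thm. 3.2, Prop. 3.6 (a), p. 656]
[cite: GoodmanWallachGTM255, Thm. 5.3.3] -/
theorem specialLefschetzGroup_invariants_le_powSucc_of_selfAdjoint (φ : A ⟶ A)
    (hC : centralizerAlgebra A = Subalgebra.centralizer ℂ {pullbackOne A φ})
    (hdiag : ⨆ μ : ℂ, Module.End.eigenspace (pullbackOne A φ) μ = ⊤)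
    (h2 : ∀ μ : ℂ, Module.finrank ℂ (Module.End.eigenspace (pullbackOne A φ) μ) ≤ 2)
    {h : complexBetti A.X 2} (hQ : IsRationalClass h)
    (hK : ∃ s : ℝ, 0 < s ∧ IsKaehlerClass A.dim A.X ((s : ℂ) • h))
    (hJQ : ∀ x y : complexBetti A.X 1,
      polarizationPairingOne A.X h (A.dim - 1) (pullbackOne A φ x) y =
        polarizationPairingOne A.X h (A.dim - 1) x (pullbackOne A φ y))
    (N p : ℕ) (x : complexBetti (A.powSucc N).X (2 * p))
    (hx : ∀ g ∈ specialLefschetzGroup (A.powSucc N).dim (A.powSucc N).X, g (2 * p) x = x) :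
    x ∈ divisorClassesSpan (A.powSucc N).X (A.powSucc N).dim p := by
  classical
  have hX := AbelianVariety.hasExteriorCohomologyH1_complexPoints (A.powSucc N)
  rcases Nat.eq_zero_or_pos A.dim with hA | hA0
  · -- dimension `0`: `H^{2p}(A^{N+1}) = 0` for `p ≥ 1`, `H⁰ = ℂ · 1`
    rcases Nat.eq_zero_or_pos p with rfl | hp1
    · have htop : Submodule.span ℂ (Set.range (cupPowOne ℂ (ComplexPoints (A.powSucc N).X) 0)) = ⊤ :=
        hX.span_range_cupPowOne 0
      have hrange : Set.range (cupPowOne ℂ (ComplexPoints (A.powSucc N).X) 0) =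
          {singularCohomology.one ℂ (ComplexPoints (A.powSucc N).X)} := by
        ext c
        simp only [Set.mem_range, cupPowOne_zero, Set.mem_singleton_iff]
        exact ⟨fun ⟨_, e⟩ => e.symm, fun e => ⟨fun i => Fin.elim0 i, e.symm⟩⟩
      have hx' : x ∈ Submodule.span ℂ (Set.range (cupPowOne ℂ (ComplexPoints (A.powSucc N).X) 0)) := by
        rw [htop]; exact Submodule.mem_top
      rw [hrange] at hx'
      refine Submodule.span_mono (fun c hc => ?_) hx'
      rw [Set.mem_singleton_iff] at hc
      exact mem_divisorMonomials_zero.2 hc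
    · haveI : Module.Finite ℂ (complexBetti (A.powSucc N).X 1) :=
        abelianVarietyCohomologyExteriorH1_holds.finite_one (A.powSucc N)
      haveI : Subsingleton (complexBetti (A.powSucc N).X (2 * p)) :=
        hX.subsingleton_of_lt (by rw [AbelianVariety.finrank_complexBetti_one, dim_powSucc_eq_succ_mul, hA]; omega)
      rw [Subsingleton.elim x 0]
      exact Submodule.zero_mem _
  · exact specialLefschetzGroup_invariants_le_of_exists_polarization_invariants_le (dim_powSucc_pos hA0 N)
      (exists_polarization_invariants_le_powSucc_of_selfAdjoint φ hC hdiag h2 hQ hK hJQ hA0 N) p x hx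

/-- **The record for every complex abelian variety ISOGENOUS to a power of a `GL₂`-type abelian variety with
real multiplication** ("`S(A)` depends only on the isogeny class of `A`", §1 p. 644; Cor. 4.7).
[cite: Milne1999LefschetzClasses, §1 p. 644, Prop. 1.5, Cor. 4.5 and Cor. 4.7 (p. 659)] -/
theorem specialLefschetzGroup_invariants_le_of_isIsogenous_powSucc_of_selfAdjoint {X : AbelianVariety ℂ} (φ : A ⟶ A)
    (hC : centralizerAlgebra A = Subalgebra.centralizer ℂ {pullbackOne A φ})
    (hdiag : ⨆ μ : ℂ, Module.End.eigenspace (pullbackOne A φ) μ = ⊤)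
    (h2 : ∀ μ : ℂ, Module.finrank ℂ (Module.End.eigenspace (pullbackOne A φ) μ) ≤ 2)
    {h : complexBetti A.X 2} (hQ : IsRationalClass h)
    (hK : ∃ s : ℝ, 0 < s ∧ IsKaehlerClass A.dim A.X ((s : ℂ) • h))
    (hJQ : ∀ x y : complexBetti A.X 1,
      polarizationPairingOne A.X h (A.dim - 1) (pullbackOne A φ x) y =
        polarizationPairingOne A.X h (A.dim - 1) x (pullbackOne A φ y))
    (hA0 : 0 < A.dim) {N : ℕ} (hXA : AbelianVariety.IsIsogenous X (A.powSucc N)) (p : ℕ)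
    (x : complexBetti X.X (2 * p)) (hx : ∀ g ∈ specialLefschetzGroup X.dim X.X, g (2 * p) x = x) :
    x ∈ divisorClassesSpan X.X X.dim p :=
  specialLefschetzGroup_invariants_le_of_isIsogenous_of_exists hXA (dim_powSucc_pos hA0 N)
    (exists_polarization_invariants_le_powSucc_of_selfAdjoint φ hC hdiag h2 hQ hK hJQ hA0 N) p x hx

/-- **Cor. 4.5 as an equality of sets on the powers of a `GL₂`-type abelian variety with real multiplication**:
the `S(A^{N+1})`-invariants of `H^{2p}(A^{N+1}(ℂ); ℂ)` are EXACTLY `Dᵖ_hom(A^{N+1})_ℂ` (the converse inclusion is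
definitional, `apply_eq_self_of_mem_specialLefschetzGroup`). [cite: Milne1999LefschetzClasses, Cor. 4.5 (p. 659)] -/
theorem setOf_forall_apply_eq_self_eq_divisorClassesSpan_powSucc_of_selfAdjoint (φ : A ⟶ A)
    (hC : centralizerAlgebra A = Subalgebra.centralizer ℂ {pullbackOne A φ})
    (hdiag : ⨆ μ : ℂ, Module.End.eigenspace (pullbackOne A φ) μ = ⊤)
    (h2 : ∀ μ : ℂ, Module.finrank ℂ (Module.End.eigenspace (pullbackOne A φ) μ) ≤ 2)
    {h : complexBetti A.X 2} (hQ : IsRationalClass h)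
    (hK : ∃ s : ℝ, 0 < s ∧ IsKaehlerClass A.dim A.X ((s : ℂ) • h))
    (hJQ : ∀ x y : complexBetti A.X 1,
      polarizationPairingOne A.X h (A.dim - 1) (pullbackOne A φ x) y =
        polarizationPairingOne A.X h (A.dim - 1) x (pullbackOne A φ y))
    (N p : ℕ) :
    {x : complexBetti (A.powSucc N).X (2 * p) |
        ∀ g ∈ specialLefschetzGroup (A.powSucc N).dim (A.powSucc N).X, g (2 * p) x = x} =
      (divisorClassesSpan (A.powSucc N).X (A.powSucc N).dim p : Set _) :=
  Set.Subset.antisymm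
    (fun x hx => specialLefschetzGroup_invariants_le_powSucc_of_selfAdjoint φ hC hdiag h2 hQ hK hJQ N p x hx)
    fun _ hx _ hg => apply_eq_self_of_mem_specialLefschetzGroup hg hx

/-- **Milne Prop. 4.8, (c) ⇒ (a) on every power of a `GL₂`-type abelian variety with real multiplication,
record-free**: if `Hg′(A^{N+1}) = S(A^{N+1})` then `A^{N+1}` supports no exotic Hodge class (van Geemen's
`B(A^{N+1}) = D(A^{N+1})`). [cite: Milne1999LefschetzClasses, Prop. 4.8 and Cor. 4.5 (pp. 659–660)] -/
theorem isDivisorGenerated_powSucc_of_hodgeGroup_eq_specialLefschetzGroup_of_selfAdjoint (φ : A ⟶ A)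
    (hC : centralizerAlgebra A = Subalgebra.centralizer ℂ {pullbackOne A φ})
    (hdiag : ⨆ μ : ℂ, Module.End.eigenspace (pullbackOne A φ) μ = ⊤)
    (h2 : ∀ μ : ℂ, Module.finrank ℂ (Module.End.eigenspace (pullbackOne A φ) μ) ≤ 2)
    {h : complexBetti A.X 2} (hQ : IsRationalClass h)
    (hK : ∃ s : ℝ, 0 < s ∧ IsKaehlerClass A.dim A.X ((s : ℂ) • h))
    (hJQ : ∀ x y : complexBetti A.X 1,
      polarizationPairingOne A.X h (A.dim - 1) (pullbackOne A φ x) y =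
        polarizationPairingOne A.X h (A.dim - 1) x (pullbackOne A φ y))
    (N : ℕ)
    (hHg : hodgeGroup (A.powSucc N).dim (A.powSucc N).X =
      specialLefschetzGroup (A.powSucc N).dim (A.powSucc N).X) :
    IsDivisorGenerated (A.powSucc N) :=
  fun p c hc hpp => specialLefschetzGroup_invariants_le_powSucc_of_selfAdjoint φ hC hdiag h2 hQ hK hJQ N p c
    fun _ hg => apply_eq_self_of_mem_hodgeGroup (hHg ▸ hg) hc hpp

end Main

end Literature.AlgebraicGeometry.Milne1999

end
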